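import Literature.NumberTheory.BeurlingPrimes.DeletedPrimesLogZeta
import Literature.NumberTheory.BeurlingPrimes.DeletedPrimesHyperbola
import Literature.NumberTheory.LFunctions.RHLittlewoodZetaBounds
import Mathlib.NumberTheory.EulerProduct.DirichletLSeries
import Mathlib.NumberTheory.LSeries.Basic
import HarnessLib

/-!
# `1/ζ_𝒮(s) = ζ(s+1−α)^{−1} e^{−logCorr(s)}`: the Möbius series of the deleted primes and its RH continuation

Topic `Literature/NumberTheory/BeurlingPrimes`, grouping namespace `PrimeWeight`. Everything in this file is
PROVED.

Broucke–Debruyne–Révész (arXiv:2309.01567), §5 p. 16: "the characteristic function of the remaining integers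
`𝒩 = {n ∈ ℕ : p | n ⇒ p ∉ 𝒫_𝒮}` can be written as the convolution `1_𝒩 = 1_ℕ ∗ μ_𝒮`, where … `μ_𝒮` is the Möbius
function of `𝒫_𝒮` … `log ζ_𝒮(s) = log ζ(s + 1 − α) + O_ε(√log|t|)`. … This implies that both `ζ_𝒮(s)` and
`1/ζ_𝒮(s)` are `≪_ε |t|^ε` on each half-plane `Re s ≥ α/2 + ε`. (RH implies that both `ζ(s)` and `1/ζ(s)` are
`≪_ε |t|^ε` on half-planes `Re s ≥ 1/2 + ε`.)"

With `logCorr` from `DeletedPrimesLogZeta.lean` (holomorphic on `σ > α/2`, `≪_ε √log|t|`), here: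

* the Dirichlet series `moebSeries S s = Σ_n μ_𝒮(n) n^{−s}` (`= 1/ζ_𝒮(s)`) of the `𝒮`-Möbius function (tree: `moebS`,
  `IsSmooth`, `DeletedPrimesHyperbola.lean`), absolutely convergent for `σ > 1`;
* **the exponentiated identity** `moebSeries S s = ζ(s+1−α)^{−1} · e^{−logCorr(s)}` for `σ > 1`
  (`moebSeries_eq`): Euler products for the multiplicative `μ_𝒮 n^{−s}` (Mathlib `EulerProduct.eulerProduct_hasProd`)
  and for `ζ` (Mathlib `riemannZeta_eulerProduct_exp_log`), and `W(s) = Σ_{p∈S}p^{−s} − Σ_p p^{α−1−s}`;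
* `invZetaS S α s = (s − α)/ζ₁(s+1−α) · e^{−logCorr(s)}` (`ζ₁` = Mathlib's entire `riemannZeta₁ = (s−1)ζ(s)`): equal to
  `moebSeries` on `σ > 1`, and UNDER RH holomorphic on `σ > α/2` with `‖invZetaS(s)‖ ≤ C_ε (1 + |t|)^ε` on
  `σ ≥ α/2 + ε` (tree: Littlewood's `(s−1)/ζ₁(s) ≪ (1+|t|)^ε` on `σ ≥ σ₀ > 1/2`, `RHLittlewoodZetaBounds.lean`);
* the `𝒮`-free integers: `freeSeries S s = Σ_{n 𝒮-free} n^{−s} = ζ(s) · moebSeries S s` for `σ > 1`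
  (`freeSeries_eq`; BDR's "`1_𝒩 = 1_ℕ ∗ μ_𝒮`", via the completely multiplicative Euler product).

## References
* [BrouckeDebruyneRevesz2023] F. Broucke, G. Debruyne, Sz. Gy. Révész, *Some examples of well-behaved Beurling
  number systems*, arXiv:2309.01567, §5 p. 16 (read).
* [Titchmarsh1986] E. C. Titchmarsh, *The Theory of the Riemann Zeta-Function*, 2nd ed., Thm. 14.2 (tree).
-/

noncomputable section

open Complex Set Filter Finset
open scoped Topology

namespace Literature.NumberTheory.BeurlingPrimes

namespace PrimeWeight

open ArithmeticFunction

/-! ### The `𝒮`-Möbius function (tree: `moebS`, `IsSmooth`, `DeletedPrimesHyperbola.lean`) -/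

/-- `‖(μ_𝒮(n) : ℂ)‖ ≤ 1` (tree: `abs_moebS_le_one`). [folklore] -/
theorem norm_moebS_le (S : Set ℕ) (n : ℕ) : ‖((moebS S n : ℝ) : ℂ)‖ ≤ 1 := by
  rw [Complex.norm_real, Real.norm_eq_abs]; exact abs_moebS_le_one S n

/-- `μ_𝒮` is multiplicative on coprime arguments (tree: `isMultiplicative_moebSFun`). [folklore] -/
theorem moebS_mul_coprime (S : Set ℕ) {m n : ℕ} (hmn : m.Coprime n) : moebS S (m * n) = moebS S m * moebS S n :=
  (isMultiplicative_moebSFun S).map_mul_of_coprime hmn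

/-- At a prime: `μ_𝒮(p) = −1_S(p)`. [folklore] -/
theorem moebS_prime (S : Set ℕ) {p : ℕ} (hp : p.Prime) : ((moebS S p : ℝ) : ℂ) = -(indSet S p : ℂ) := by
  classical
  unfold moebS indSet
  rw [show IsSmooth S p ↔ p ∈ S by simpa using isSmooth_prime_pow_iff (S := S) hp one_ne_zero,
    ArithmeticFunction.moebius_apply_prime hp]
  by_cases h : p ∈ S <;> simp [h]

/-- At a higher prime power: `μ_𝒮(p^k) = 0` for `k ≥ 2`. [folklore] -/
theorem moebS_prime_pow (S : Set ℕ) {p k : ℕ} (hp : p.Prime) (hk : 2 ≤ k) : moebS S (p ^ k) = 0 := by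
  classical
  unfold moebS
  have hk1 : k ≠ 1 := by omega
  rw [ArithmeticFunction.moebius_apply_prime_pow hp (by omega)]
  simp [hk1]

/-! ### The Dirichlet series `Σ μ_𝒮(n) n^{−s} = 1/ζ_𝒮(s)` -/

/-- The summand `μ_𝒮(n) n^{−s}`. [cite: BrouckeDebruyneRevesz2023, §5 p. 16] -/
def moebTerm (S : Set ℕ) (s : ℂ) (n : ℕ) : ℂ := ((moebS S n : ℝ) : ℂ) * (n : ℂ) ^ (-s)

/-- **`1/ζ_𝒮(s) = Σ_n μ_𝒮(n) n^{−s}`** as an absolutely convergent series (`σ > 1`). [cite: BrouckeDebruyneRevesz2023, §5 p. 16] -/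
def moebSeries (S : Set ℕ) (s : ℂ) : ℂ := ∑' n : ℕ, moebTerm S s n

/-- `‖μ_𝒮(n) n^{−s}‖ ≤ n^{−σ}`. [folklore] -/
theorem norm_moebTerm_le (S : Set ℕ) (s : ℂ) (n : ℕ) : ‖moebTerm S s n‖ ≤ (n : ℝ) ^ (-s.re) := by
  unfold moebTerm
  rcases Nat.eq_zero_or_pos n with rfl | hn
  · simp [moebS_zero]
    exact Real.rpow_nonneg le_rfl _
  rw [norm_mul, Complex.norm_natCast_cpow_of_pos hn, neg_re]
  calc ‖((moebS S n : ℝ) : ℂ)‖ * (n : ℝ) ^ (-s.re) ≤ 1 * (n : ℝ) ^ (-s.re) :=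
        mul_le_mul_of_nonneg_right (norm_moebS_le S n) (Real.rpow_nonneg (Nat.cast_nonneg n) _)
    _ = (n : ℝ) ^ (-s.re) := one_mul _

/-- Absolute convergence for `σ > 1`. [folklore] -/
theorem summable_norm_moebTerm (S : Set ℕ) {s : ℂ} (hs : 1 < s.re) : Summable fun n ↦ ‖moebTerm S s n‖ :=
  Summable.of_nonneg_of_le (fun n ↦ norm_nonneg _) (norm_moebTerm_le S s)
    (Real.summable_nat_rpow.mpr (by linarith))

/-- The summand is Mathlib's `LSeries.term` of `n ↦ μ_𝒮(n)`. [folklore] -/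
theorem moebTerm_eq_term (S : Set ℕ) (s : ℂ) (n : ℕ) : moebTerm S s n = LSeries.term (fun n ↦ ((moebS S n : ℝ) : ℂ)) s n := by
  unfold moebTerm
  rcases eq_or_ne n 0 with rfl | hn
  · simp [moebS_zero, LSeries.term_zero]
  · rw [LSeries.term_of_ne_zero hn, cpow_neg, div_eq_mul_inv]

/-- `moebSeries S s = L(μ_𝒮, s)` (Mathlib's `LSeries`). [folklore] -/
theorem moebSeries_eq_LSeries (S : Set ℕ) (s : ℂ) : moebSeries S s = LSeries (fun n ↦ ((moebS S n : ℝ) : ℂ)) s :=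
  tsum_congr (moebTerm_eq_term S s)

/-- `L(μ_𝒮, s)` converges absolutely for `σ > 1`. [folklore] -/
theorem LSeriesSummable_moebS (S : Set ℕ) {s : ℂ} (hs : 1 < s.re) : LSeriesSummable (fun n ↦ ((moebS S n : ℝ) : ℂ)) s := by
  have h := (summable_norm_moebTerm S hs).of_norm
  exact h.congr (moebTerm_eq_term S s)

/-- `μ_𝒮 n^{−s}` is multiplicative on coprime arguments and vanishes at `0`, equals `1` at `1`. [folklore] -/
theorem moebTerm_mul_coprime (S : Set ℕ) (s : ℂ) {m n : ℕ} (hmn : m.Coprime n) :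
    moebTerm S s (m * n) = moebTerm S s m * moebTerm S s n := by
  unfold moebTerm
  rw [moebS_mul_coprime S hmn, ofReal_mul, Nat.cast_mul, Complex.natCast_mul_natCast_cpow]
  ring

/-- The local Euler factor: `Σ_e μ_𝒮(p^e) p^{−es} = 1 − 1_S(p) p^{−s}`. [folklore] -/
theorem tsum_moebTerm_prime_pow (S : Set ℕ) (s : ℂ) {p : ℕ} (hp : p.Prime) :
    ∑' e : ℕ, moebTerm S s (p ^ e) = 1 - (indSet S p : ℂ) * (p : ℂ) ^ (-s) := by
  have hvan : ∀ e ∉ ({0, 1} : Finset ℕ), moebTerm S s (p ^ e) = 0 := by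
    intro e he
    simp only [Finset.mem_insert, Finset.mem_singleton, not_or] at he
    unfold moebTerm
    rw [moebS_prime_pow S hp (by omega), ofReal_zero, zero_mul]
  rw [tsum_eq_sum hvan, Finset.sum_pair zero_ne_one]
  unfold moebTerm
  rw [pow_zero, pow_one, moebS_one, moebS_prime S hp]
  simp only [Nat.cast_one, Complex.one_cpow, mul_one, ofReal_one]
  ring

/-- **Euler product**: `Π_p (1 − 1_S(p) p^{−s}) = Σ_n μ_𝒮(n) n^{−s}` for `σ > 1`. [cite: BrouckeDebruyneRevesz2023, §5 p. 16] -/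
theorem hasProd_moebSeries (S : Set ℕ) {s : ℂ} (hs : 1 < s.re) :
    HasProd (fun p : Nat.Primes ↦ 1 - (indSet S p : ℂ) * ((p : ℕ) : ℂ) ^ (-s)) (moebSeries S s) := by
  have h := EulerProduct.eulerProduct_hasProd (f := moebTerm S s) (by simp [moebTerm, moebS_one])
    (fun hmn ↦ moebTerm_mul_coprime S s hmn) (summable_norm_moebTerm S hs) (by simp [moebTerm, moebS_zero])
  unfold moebSeries
  exact h.congr_fun fun p ↦ (tsum_moebTerm_prime_pow S s p.prop).symm

/-! ### The factor `1 − 1_S(p) p^{−s}` and its logarithm -/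

/-- `‖1_S(p) p^{−s}‖ < 1` for `p ≥ 2`, `σ > 0`. [folklore] -/
theorem norm_indSet_mul_cpow_lt_one (S : Set ℕ) {p : ℕ} (hp : 2 ≤ p) {s : ℂ} (hs : 0 < s.re) :
    ‖(indSet S p : ℂ) * (p : ℂ) ^ (-s)‖ < 1 := by
  rw [norm_mul, Complex.norm_real, Real.norm_eq_abs, abs_of_nonneg (indSet_mem_Icc S p).1,
    norm_natCast_cpow_neg (by omega) s]
  have h1 : (p : ℝ) ^ (-s.re) < 1 := Real.rpow_lt_one_of_one_lt_of_neg (by exact_mod_cast (by omega : 1 < p)) (by linarith)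
  have h2 := (indSet_mem_Icc S p).2
  have h3 : 0 ≤ (p : ℝ) ^ (-s.re) := Real.rpow_nonneg (Nat.cast_nonneg p) _
  nlinarith

/-- **`log(1 − 1_S(p)p^{−s}) = −1_S(p)(p^{−s} + eTerm p s)`** (both sides vanish for `p ∉ S`). [folklore] -/
theorem log_one_sub_indSet (S : Set ℕ) (p : ℕ) (s : ℂ) :
    Complex.log (1 - (indSet S p : ℂ) * (p : ℂ) ^ (-s)) = -(indSet S p : ℂ) * ((p : ℂ) ^ (-s) + eTerm p s) := by
  by_cases h : p ∈ S
  · rw [indSet_of_mem h]; unfold eTerm; push_cast; ring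
  · rw [indSet_of_notMem h]; simp

/-! ### The logarithms of the Euler factors and the exponentiated identity on `σ > 1` -/

variable {S : Set ℕ} {α A : ℝ}

/-- The logarithm of one Euler factor of `1/ζ_𝒮`: `L_p(s) = log(1 − 1_S(p) p^{−s})`. [folklore] -/
def logFactor (S : Set ℕ) (s : ℂ) (p : Nat.Primes) : ℂ := Complex.log (1 - (indSet S p : ℂ) * ((p : ℕ) : ℂ) ^ (-s))

/-- Summability of `Σ_p 1_S(p) p^{−s}` over the primes for `σ > 1`. [folklore] -/
theorem summable_indSet_cpow (S : Set ℕ) {s : ℂ} (hs : 1 < s.re) :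
    Summable fun p : Nat.Primes ↦ (indSet S p : ℂ) * ((p : ℕ) : ℂ) ^ (-s) := by
  have := (summable_primeTerm (c := indSet S) (fun p ↦ by
    rw [abs_of_nonneg (indSet_mem_Icc S p).1]; exact (indSet_mem_Icc S p).2) hs).subtype Nat.Prime
  refine this.congr fun p ↦ ?_
  simp [primeTerm]

/-- Summability of `Σ_p p^{−s}` over the primes for `σ > 1`. [folklore] -/
theorem summable_primes_cpow {s : ℂ} (hs : 1 < s.re) : Summable fun p : Nat.Primes ↦ ((p : ℕ) : ℂ) ^ (-s) := by
  have := (summable_primeTerm (c := fun _ ↦ (1 : ℝ)) (by intro; simp) hs).subtype Nat.Prime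
  refine this.congr fun p ↦ ?_
  simp [primeTerm]

/-- Summability of `Σ_p 1_S(p) eTerm p s` for `σ > 1` (unconditionally: `|eTerm| ≤ K p^{−2σ}`). [folklore] -/
theorem summable_indSet_eTerm' (S : Set ℕ) {s : ℂ} (hs : 1 < s.re) :
    Summable fun p : Nat.Primes ↦ (indSet S p : ℂ) * eTerm p s := by
  refine Summable.of_norm_bounded ((summable_eTerm (σ₀ := 1) (by norm_num) hs.le).norm) fun p ↦ ?_
  rw [norm_mul, Complex.norm_real, Real.norm_eq_abs, abs_of_nonneg (indSet_mem_Icc S p).1]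
  calc indSet S p * ‖eTerm p s‖ ≤ 1 * ‖eTerm p s‖ :=
        mul_le_mul_of_nonneg_right (indSet_mem_Icc S p).2 (norm_nonneg _)
    _ = ‖eTerm p s‖ := one_mul _

/-- `L_p = −1_S(p)p^{−s} − 1_S(p) eTerm p s`. [folklore] -/
theorem logFactor_eq (S : Set ℕ) (s : ℂ) (p : Nat.Primes) :
    logFactor S s p = -((indSet S p : ℂ) * ((p : ℕ) : ℂ) ^ (-s)) - (indSet S p : ℂ) * eTerm p s := by
  unfold logFactor; rw [log_one_sub_indSet]; ring

/-- The `L_p` are summable for `σ > 1`. [folklore] -/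
theorem summable_logFactor (S : Set ℕ) {s : ℂ} (hs : 1 < s.re) : Summable (logFactor S s) :=
  ((summable_indSet_cpow S hs).neg.sub (summable_indSet_eTerm' S hs)).congr fun p ↦ (logFactor_eq S s p).symm

/-- **`exp(Σ_p L_p) = Σ_n μ_𝒮(n) n^{−s}`** for `σ > 1` (both sides are `Π_p (1 − 1_S(p)p^{−s})`, by uniqueness of the
limit of the Euler product). [cite: BrouckeDebruyneRevesz2023, §5 p. 16] -/
theorem exp_tsum_logFactor (S : Set ℕ) {s : ℂ} (hs : 1 < s.re) :
    Complex.exp (∑' p, logFactor S s p) = moebSeries S s := by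
  have hs0 : 0 < s.re := by linarith
  have hprod1 := hasProd_moebSeries S hs
  have hprod2 : HasProd (fun p : Nat.Primes ↦ 1 - (indSet S p : ℂ) * ((p : ℕ) : ℂ) ^ (-s))
      (Complex.exp (∑' p, logFactor S s p)) := by
    refine (summable_logFactor S hs).hasSum.cexp.congr_fun fun p ↦ ?_
    simp only [Function.comp_apply, logFactor]
    rw [Complex.exp_log]
    intro h0
    have h1 := norm_indSet_mul_cpow_lt_one S (two_le_prime p) hs0
    rw [sub_eq_zero] at h0
    rw [← h0, norm_one] at h1
    exact lt_irrefl _ h1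
  exact (hprod1.unique hprod2).symm

/-- `(p^{α−1} : ℝ) · p^{−s} = p^{−(s+1−α)}` for `p > 0`. [folklore] -/
theorem powWeight_mul_cpow {p : ℕ} (hp : 0 < p) (α : ℝ) (s : ℂ) :
    ((p : ℝ) ^ (α - 1) : ℝ) * (p : ℂ) ^ (-s) = (p : ℂ) ^ (-(s + 1 - α)) := by
  have hp0 : (p : ℂ) ≠ 0 := by exact_mod_cast hp.ne'
  rw [show (((p : ℝ) ^ (α - 1) : ℝ) : ℂ) = (p : ℂ) ^ ((α - 1 : ℝ) : ℂ) by
    rw [show (p : ℂ) = ((p : ℝ) : ℂ) by simp, ← ofReal_cpow (Nat.cast_nonneg p)], ← cpow_add _ _ hp0]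
  congr 1; push_cast; ring

/-- `Σ'_p 1_S(p) p^{−s} = W(s) + Σ'_p p^{−(s+1−α)}` for `σ > 1` (`W = cont (selWeight S α)`). [cite: BrouckeDebruyneRevesz2023, §5 p. 16] -/
theorem tsum_indSet_cpow_eq (h : Adjusted S α A) {s : ℂ} (hs : 1 < s.re) :
    ∑' p : Nat.Primes, (indSet S p : ℂ) * ((p : ℕ) : ℂ) ^ (-s) =
      cont (selWeight S α) s + ∑' p : Nat.Primes, ((p : ℕ) : ℂ) ^ (-(s + 1 - α)) := by
  have hW := cont_eq_tsum h.isBounded hs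
  have hsumW : Summable fun p : Nat.Primes ↦ (selWeight S α p : ℂ) * ((p : ℕ) : ℂ) ^ (-s) := by
    have := (summable_primeTerm (abs_selWeight_le S h.lt_one.le) hs).subtype Nat.Prime
    refine this.congr fun p ↦ ?_
    simp [primeTerm]
  have hs' : 1 < (s + 1 - α).re := by simp only [sub_re, add_re, one_re, ofReal_re]; linarith [h.lt_one]
  rw [hW, ← hsumW.tsum_add (summable_primes_cpow hs')]
  refine tsum_congr fun p ↦ ?_
  rw [← powWeight_mul_cpow p.prop.pos α s]
  unfold selWeight
  push_cast; ring

/-- `Σ'_p p^{−s'} = Σ'_p (−log(1 − p^{−s'})) − E₁(s')` for `σ' > 1`, and the log-sum is summable. [folklore] -/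
theorem tsum_primes_cpow_eq {s' : ℂ} (hs' : 1 < s'.re) :
    Summable (fun p : Nat.Primes ↦ -Complex.log (1 - ((p : ℕ) : ℂ) ^ (-s'))) ∧
    ∑' p : Nat.Primes, ((p : ℕ) : ℂ) ^ (-s') =
      (∑' p : Nat.Primes, -Complex.log (1 - ((p : ℕ) : ℂ) ^ (-s'))) - primeTail s' := by
  have hsumZ := summable_primes_cpow hs'
  have hsumE : Summable fun p : Nat.Primes ↦ eTerm p s' := summable_eTerm (σ₀ := 1) (by norm_num) hs'.le
  have hident : ∀ p : Nat.Primes, -Complex.log (1 - ((p : ℕ) : ℂ) ^ (-s')) = ((p : ℕ) : ℂ) ^ (-s') + eTerm p s' := by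
    intro p; unfold eTerm; ring
  have hsumL : Summable (fun p : Nat.Primes ↦ -Complex.log (1 - ((p : ℕ) : ℂ) ^ (-s'))) :=
    (hsumZ.add hsumE).congr fun p ↦ (hident p).symm
  refine ⟨hsumL, ?_⟩
  rw [tsum_congr hident, hsumZ.tsum_add hsumE]
  unfold primeTail
  ring

/-- **`Σ_p L_p = −(W(s) + Σ_p(−log(1 − p^{−(s+1−α)})) − E₁(s+1−α)) − E₁^S(s)`** for `σ > 1`. [cite: BrouckeDebruyneRevesz2023, §5 p. 16] -/
theorem tsum_logFactor_eq (h : Adjusted S α A) {s : ℂ} (hs : 1 < s.re) :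
    ∑' p, logFactor S s p =
      -(cont (selWeight S α) s + ((∑' p : Nat.Primes, -Complex.log (1 - ((p : ℕ) : ℂ) ^ (-(s + 1 - α)))) -
        primeTail (s + 1 - α))) - smoothTail S s := by
  have hs' : 1 < (s + 1 - α).re := by simp only [sub_re, add_re, one_re, ofReal_re]; linarith [h.lt_one]
  rw [tsum_congr (logFactor_eq S s), (summable_indSet_cpow S hs).neg.tsum_sub (summable_indSet_eTerm' S hs),
    tsum_neg, tsum_indSet_cpow_eq h hs, (tsum_primes_cpow_eq hs').2]
  rfl

/-- **The exponentiated identity** (BDR's "`log ζ_𝒮(s) = log ζ(s+1−α) + O_ε(√log|t|)`" without logarithms):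
for `σ > 1`, `Σ_n μ_𝒮(n) n^{−s} = ζ(s + 1 − α)^{−1} · exp(−logCorr(s))`. [cite: BrouckeDebruyneRevesz2023, §5 p. 16] -/
theorem moebSeries_eq (h : Adjusted S α A) {s : ℂ} (hs : 1 < s.re) :
    moebSeries S s = (riemannZeta (s + 1 - α))⁻¹ * Complex.exp (-logCorr S α s) := by
  have hs' : 1 < (s + 1 - α).re := by simp only [sub_re, add_re, one_re, ofReal_re]; linarith [h.lt_one]
  rw [← exp_tsum_logFactor S hs, tsum_logFactor_eq h hs, ← riemannZeta_eulerProduct_exp_log hs', ← Complex.exp_neg,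
    ← Complex.exp_add]
  unfold logCorr
  congr 1; ring

/-! ### The `𝒮`-free integers: `Σ_{n 𝒮-free} n^{−s} = ζ(s) Σ_n μ_𝒮(n) n^{−s}` -/

/-- `freeInd S (mn) = freeInd S m · freeInd S n` (the `𝒮`-free indicator is completely multiplicative). [folklore] -/
theorem freeInd_mul (S : Set ℕ) (m n : ℕ) : freeInd S (m * n) = freeInd S m * freeInd S n := by
  classical
  unfold freeInd
  rcases Nat.eq_zero_or_pos m with rfl | hm
  · simp
  rcases Nat.eq_zero_or_pos n with rfl | hn
  · simp
  have hiff : IsFree S (m * n) ↔ IsFree S m ∧ IsFree S n := by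
    simp only [IsFree, Nat.primeFactors_mul hm.ne' hn.ne', Finset.mem_union]
    exact ⟨fun h ↦ ⟨fun p hp ↦ h p (Or.inl hp), fun p hp ↦ h p (Or.inr hp)⟩, fun h p hp ↦ hp.elim (h.1 p) (h.2 p)⟩
  by_cases h1 : IsFree S m <;> by_cases h2 : IsFree S n <;>
    simp [h1, h2, hiff, hm.ne', hn.ne', Nat.mul_ne_zero hm.ne' hn.ne']

/-- At a prime: `freeInd S p = 1 − 1_S(p)`. [folklore] -/
theorem freeInd_prime (S : Set ℕ) {p : ℕ} (hp : p.Prime) : freeInd S p = 1 - indSet S p := by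
  classical
  unfold freeInd indSet
  have hiff : IsFree S p ↔ p ∉ S := by simp [IsFree, hp.primeFactors]
  by_cases h : p ∈ S <;> simp [h, hiff, hp.ne_zero]

/-- The summand `1_{n 𝒮-free} n^{−s}`. [cite: BrouckeDebruyneRevesz2023, §5 p. 16] -/
def freeTerm (S : Set ℕ) (s : ℂ) (n : ℕ) : ℂ := (freeInd S n : ℂ) * (n : ℂ) ^ (-s)

/-- **`Σ_{n 𝒮-free} n^{−s}`** (the zeta function of the kept primes `ℙ ∖ 𝒮`), absolutely convergent for `σ > 1`.
[cite: BrouckeDebruyneRevesz2023, §5 p. 16] -/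
def freeSeries (S : Set ℕ) (s : ℂ) : ℂ := ∑' n : ℕ, freeTerm S s n

/-- `n ↦ 1_{n free} n^{−s}` as a completely multiplicative function `ℕ →*₀ ℂ`. [folklore] -/
def freeHom (S : Set ℕ) (s : ℂ) : ℕ →*₀ ℂ where
  toFun := freeTerm S s
  map_zero' := by simp [freeTerm]
  map_one' := by simp [freeTerm]
  map_mul' m n := by
    simp only [freeTerm]
    rw [freeInd_mul, Nat.cast_mul, Complex.natCast_mul_natCast_cpow]
    push_cast; ring

/-- `‖1_{n free} n^{−s}‖ ≤ n^{−σ}`, so the series converges absolutely for `σ > 1`. [folklore] -/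
theorem summable_norm_freeTerm (S : Set ℕ) {s : ℂ} (hs : 1 < s.re) : Summable fun n ↦ ‖freeTerm S s n‖ := by
  refine Summable.of_nonneg_of_le (fun n ↦ norm_nonneg _) (fun n ↦ ?_) (Real.summable_nat_rpow.mpr (by linarith : -s.re < -1))
  unfold freeTerm
  rcases Nat.eq_zero_or_pos n with rfl | hn
  · simp
    exact Real.rpow_nonneg le_rfl _
  rw [norm_mul, Complex.norm_natCast_cpow_of_pos hn, neg_re, Complex.norm_real, Real.norm_eq_abs,
    abs_of_nonneg (freeInd_nonneg S n)]
  calc freeInd S n * (n : ℝ) ^ (-s.re) ≤ 1 * (n : ℝ) ^ (-s.re) :=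
        mul_le_mul_of_nonneg_right (freeInd_le_one S n) (Real.rpow_nonneg (Nat.cast_nonneg n) _)
    _ = (n : ℝ) ^ (-s.re) := one_mul _

/-- The Euler factor logarithm of the free series: `−log(1 − (1−1_S(p))p^{−s}) = −log(1 − p^{−s}) + L_p`. [folklore] -/
theorem neg_log_one_sub_freeHom (S : Set ℕ) (s : ℂ) (p : Nat.Primes) :
    -Complex.log (1 - freeHom S s p) = -Complex.log (1 - ((p : ℕ) : ℂ) ^ (-s)) + logFactor S s p := by
  show -Complex.log (1 - freeTerm S s p) = _
  unfold freeTerm logFactor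
  rw [freeInd_prime S p.prop]
  by_cases hp : (p : ℕ) ∈ S
  · rw [indSet_of_mem hp]; simp
  · rw [indSet_of_notMem hp]; simp

/-- **`Σ_{n 𝒮-free} n^{−s} = ζ(s) · Σ_n μ_𝒮(n) n^{−s}`** for `σ > 1` (BDR: "`1_𝒩 = 1_ℕ ∗ μ_𝒮`"; here via the
completely multiplicative Euler product of the left side, Mathlib `EulerProduct.exp_tsum_primes_log_eq_tsum`).
[cite: BrouckeDebruyneRevesz2023, §5 p. 16] -/
theorem freeSeries_eq (S : Set ℕ) {s : ℂ} (hs : 1 < s.re) : freeSeries S s = riemannZeta s * moebSeries S s := by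
  have h := EulerProduct.exp_tsum_primes_log_eq_tsum (f := freeHom S s) (summable_norm_freeTerm S hs)
  have hfs : freeSeries S s = ∑' n : ℕ, freeHom S s n := rfl
  rw [hfs, ← h, tsum_congr (neg_log_one_sub_freeHom S s), (tsum_primes_cpow_eq hs).1.tsum_add (summable_logFactor S hs),
    Complex.exp_add, riemannZeta_eulerProduct_exp_log hs, exp_tsum_logFactor S hs]

/-! ### The RH continuation `invZetaS(s) = (s − α)/ζ₁(s+1−α) · e^{−logCorr(s)}` -/

/-- **`1/ζ_𝒮` continued**: `invZetaS S α s = (s − α)/ζ₁(s + 1 − α) · exp(−logCorr S α s)`, where `ζ₁ = riemannZeta₁`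
(Mathlib's entire completion of `(s−1)ζ(s)`), so that `(s−α)/ζ₁(s+1−α) = ζ(s+1−α)^{−1}` off `s = α` and under RH the
whole expression is holomorphic on `σ > α/2`. [cite: BrouckeDebruyneRevesz2023, §5 p. 16] -/
def _root_.Literature.NumberTheory.BeurlingPrimes.PrimeWeight.invZetaS (S : Set ℕ) (α : ℝ) (s : ℂ) : ℂ :=
  (s - α) / riemannZeta₁ (s + 1 - α) * Complex.exp (-logCorr S α s)

/-- For `σ > 1`: `invZetaS = Σ μ_𝒮(n) n^{−s}`. [cite: BrouckeDebruyneRevesz2023, §5 p. 16] -/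
theorem invZetaS_eq_moebSeries (h : Adjusted S α A) {s : ℂ} (hs : 1 < s.re) : invZetaS S α s = moebSeries S s := by
  have hs1 : s + 1 - α ≠ 1 := by
    intro h1
    have := congrArg Complex.re h1
    simp only [sub_re, add_re, one_re, ofReal_re] at this
    linarith [h.lt_one]
  rw [moebSeries_eq h hs, invZetaS, Literature.NumberTheory.LFunctions.LittlewoodRH.inv_riemannZeta_eq _ hs1]
  congr 1; ring

/-- **Under RH, `invZetaS` is holomorphic on `σ > α/2`** (`(w−1)/ζ₁(w)` is holomorphic on `Re w > 1/2` under RH,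
tree `LittlewoodRH.differentiableOn_sub_one_div_riemannZeta₁`, and `Re(s+1−α) > 1 − α/2 > 1/2`).
[cite: BrouckeDebruyneRevesz2023, §5 p. 16] -/
theorem differentiableOn_invZetaS (h : Adjusted S α A) (hRH : RiemannHypothesis) :
    DifferentiableOn ℂ (invZetaS S α) {s : ℂ | α / 2 < s.re} := by
  have h1 : DifferentiableOn ℂ (fun s : ℂ ↦ (s + 1 - α - 1) / riemannZeta₁ (s + 1 - α)) {s : ℂ | α / 2 < s.re} := by
    have hg := Literature.NumberTheory.LFunctions.LittlewoodRH.differentiableOn_sub_one_div_riemannZeta₁ hRH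
    refine hg.comp ((differentiableOn_id.add (differentiableOn_const _)).sub (differentiableOn_const _)) fun s hs ↦ ?_
    simp only [mem_setOf_eq, sub_re, add_re, one_re, ofReal_re] at hs ⊢
    linarith [h.lt_one]
  have h2 : DifferentiableOn ℂ (fun s : ℂ ↦ Complex.exp (-logCorr S α s)) {s : ℂ | α / 2 < s.re} :=
    (h.differentiableOn_logCorr.neg).cexp
  refine (h1.mul h2).congr fun s _ ↦ ?_
  simp only [invZetaS]
  congr 2; ring

/-- `exp(K√L) ≤ exp(K²/(2δ)) · exp(δL/2)` for `L ≥ 0`, `δ > 0` (AM–GM: `K√L ≤ δL/2 + K²/(2δ)`). [folklore] -/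
theorem exp_mul_sqrt_le' (K : ℝ) {L δ : ℝ} (hL : 0 ≤ L) (hδ : 0 < δ) :
    Real.exp (K * Real.sqrt L) ≤ Real.exp (K ^ 2 / (2 * δ)) * Real.exp (δ / 2 * L) := by
  rw [← Real.exp_add, Real.exp_le_exp]
  have hsq := Real.sq_sqrt hL
  have h0 := Real.sqrt_nonneg L
  have hkey : K * Real.sqrt L * (2 * δ) ≤ K ^ 2 + δ ^ 2 * L := by nlinarith [sq_nonneg (δ * Real.sqrt L - K)]
  rw [← sub_nonneg]
  have : K ^ 2 / (2 * δ) + δ / 2 * L - K * Real.sqrt L = (K ^ 2 + δ ^ 2 * L - K * Real.sqrt L * (2 * δ)) / (2 * δ) := by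
    field_simp
  rw [this]
  exact div_nonneg (by linarith) (by linarith)

/-- `exp((δ/2) log(|t|+2)) = (|t|+2)^{δ/2} ≤ 2 (1 + |t|)^δ` for `0 < δ ≤ 1`. [folklore] -/
theorem exp_half_log_le {δ : ℝ} (hδ : 0 < δ) (hδ1 : δ ≤ 1) (t : ℝ) :
    Real.exp (δ / 2 * Real.log (|t| + 2)) ≤ 2 * (1 + |t|) ^ δ := by
  have ht : 0 ≤ |t| := abs_nonneg t
  have h2 : (0 : ℝ) < |t| + 2 := by linarith
  rw [show δ / 2 * Real.log (|t| + 2) = Real.log (|t| + 2) * (δ / 2) by ring, ← Real.rpow_def_of_pos h2]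
  calc (|t| + 2) ^ (δ / 2) ≤ (|t| + 2) ^ δ := Real.rpow_le_rpow_of_exponent_le (by linarith) (by linarith)
    _ ≤ (2 * (1 + |t|)) ^ δ := Real.rpow_le_rpow h2.le (by linarith) hδ.le
    _ = (2 : ℝ) ^ δ * (1 + |t|) ^ δ := Real.mul_rpow (by norm_num) (by linarith)
    _ ≤ 2 * (1 + |t|) ^ δ := by
        refine mul_le_mul_of_nonneg_right ?_ (Real.rpow_nonneg (by linarith) _)
        calc (2 : ℝ) ^ δ ≤ (2 : ℝ) ^ (1 : ℝ) := Real.rpow_le_rpow_of_exponent_le (by norm_num) hδ1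
          _ = 2 := Real.rpow_one 2

/-- **`exp(K g(t)) ≪_δ (1 + |t|)^δ`**: `exp(K(1 + √log(|t|+2))) ≤ 2 e^K e^{K²/(2δ)} (1 + |t|)^δ` for `0 < δ ≤ 1`. [folklore] -/
theorem exp_mul_logGauge_le (K : ℝ) {δ : ℝ} (hδ : 0 < δ) (hδ1 : δ ≤ 1) (t : ℝ) :
    Real.exp (K * logGauge t) ≤ 2 * Real.exp K * Real.exp (K ^ 2 / (2 * δ)) * (1 + |t|) ^ δ := by
  have hL : 0 ≤ Real.log (|t| + 2) := Real.log_nonneg (by linarith [abs_nonneg t])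
  unfold logGauge
  rw [mul_add, mul_one, Real.exp_add]
  have h1 := exp_mul_sqrt_le' K hL hδ
  have h2 := exp_half_log_le hδ hδ1 t
  have hA : 0 ≤ Real.exp K * Real.exp (K ^ 2 / (2 * δ)) := by positivity
  calc Real.exp K * Real.exp (K * Real.sqrt (Real.log (|t| + 2)))
      ≤ Real.exp K * (Real.exp (K ^ 2 / (2 * δ)) * Real.exp (δ / 2 * Real.log (|t| + 2))) :=
        mul_le_mul_of_nonneg_left h1 (Real.exp_pos K).le
    _ = Real.exp K * Real.exp (K ^ 2 / (2 * δ)) * Real.exp (δ / 2 * Real.log (|t| + 2)) := by ring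
    _ ≤ Real.exp K * Real.exp (K ^ 2 / (2 * δ)) * (2 * (1 + |t|) ^ δ) := mul_le_mul_of_nonneg_left h2 hA
    _ = 2 * Real.exp K * Real.exp (K ^ 2 / (2 * δ)) * (1 + |t|) ^ δ := by ring

/-- **Under RH, `‖invZetaS(s)‖ ≤ C_ε (1 + |t|)^ε` on `σ ≥ α/2 + ε`** (`0 < ε ≤ 1`): Littlewood's
`(w−1)/ζ₁(w) ≪ (1+|t|)^{ε/2}` on `Re w ≥ 1 − α/2 > 1/2` times `exp(‖logCorr‖) ≤ exp(K_ε g(t)) ≪ (1+|t|)^{ε/2}`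
(BDR: "both `ζ_𝒮(s)` and `1/ζ_𝒮(s)` are `≪_ε |t|^ε` on each half-plane `Re s ≥ α/2 + ε`").
[cite: BrouckeDebruyneRevesz2023, §5 p. 16] -/
theorem norm_invZetaS_le (h : Adjusted S α A) (hRH : RiemannHypothesis) {ε : ℝ} (hε : 0 < ε) (hε1 : ε ≤ 1) :
    ∃ C : ℝ, 0 < C ∧ ∀ s : ℂ, α / 2 + ε ≤ s.re → ‖invZetaS S α s‖ ≤ C * (1 + |s.im|) ^ ε := by
  have hα1 := h.lt_one
  have hσ₀ : 1 / 2 < 1 - α / 2 := by linarith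
  obtain ⟨C₁, hC₁, hZ⟩ :=
    Literature.NumberTheory.LFunctions.LittlewoodRH.norm_sub_one_div_riemannZeta₁_le_of_RH hRH hσ₀ (half_pos hε)
  set K : ℝ := Adjusted.corrConst S α A ε with hK
  set C₂ : ℝ := 2 * Real.exp K * Real.exp (K ^ 2 / (2 * (ε / 2))) with hC₂
  have hC₂0 : 0 < C₂ := by rw [hC₂]; positivity
  refine ⟨C₁ * C₂, mul_pos hC₁ hC₂0, fun s hs ↦ ?_⟩
  have ht : 0 ≤ |s.im| := abs_nonneg _
  -- the zeta factor
  have h1 : ‖(s - α) / riemannZeta₁ (s + 1 - α)‖ ≤ C₁ * (1 + |s.im|) ^ (ε / 2) := by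
    have hw : 1 - α / 2 ≤ (s + 1 - α).re := by simp only [sub_re, add_re, one_re, ofReal_re]; linarith
    have := hZ (s + 1 - α) hw
    have him : (s + 1 - α).im = s.im := by simp
    rw [him, show s + 1 - α - 1 = s - α by ring] at this
    exact this
  -- the exponential factor
  have h2 : ‖Complex.exp (-logCorr S α s)‖ ≤ C₂ * (1 + |s.im|) ^ (ε / 2) := by
    rw [Complex.norm_exp]
    have hre : (-logCorr S α s).re ≤ K * logGauge s.im := by
      have := h.norm_logCorr_le hε hs
      rw [← hK] at this
      have h3 : (-logCorr S α s).re ≤ ‖logCorr S α s‖ := by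
        rw [neg_re]; exact (neg_le_abs _).trans (abs_re_le_norm _)
      linarith
    refine (Real.exp_le_exp.mpr hre).trans ?_
    have := exp_mul_logGauge_le K (half_pos hε) (by linarith) s.im
    rw [hC₂]; exact this
  unfold invZetaS
  rw [norm_mul]
  have hpow : (1 + |s.im|) ^ (ε / 2) * (1 + |s.im|) ^ (ε / 2) = (1 + |s.im|) ^ ε := by
    rw [← Real.rpow_add (by linarith)]; ring_nf
  calc ‖(s - α) / riemannZeta₁ (s + 1 - α)‖ * ‖Complex.exp (-logCorr S α s)‖
      ≤ (C₁ * (1 + |s.im|) ^ (ε / 2)) * (C₂ * (1 + |s.im|) ^ (ε / 2)) :=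
        mul_le_mul h1 h2 (norm_nonneg _) (by positivity)
    _ = C₁ * C₂ * (1 + |s.im|) ^ ε := by rw [← hpow]; ring

/-- `invZetaS S α σ ≠ 0` for real `σ > α/2`, `σ ≠ α` (under RH: `ζ₁` has no zeros with real part `> 1/2`).
[cite: BrouckeDebruyneRevesz2023, §5 p. 17 ("`ζ_𝒮(s)` cannot vanish at `s = 1` or `s = β`")] -/
theorem invZetaS_ne_zero (h : Adjusted S α A) (hRH : RiemannHypothesis) {s : ℂ} (hs : α / 2 < s.re) (hsα : s ≠ α) :
    invZetaS S α s ≠ 0 := by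
  unfold invZetaS
  refine mul_ne_zero (div_ne_zero (sub_ne_zero.mpr hsα) ?_) (Complex.exp_ne_zero _)
  refine Literature.NumberTheory.LFunctions.LittlewoodRH.riemannZeta₁_ne_zero_of_RH hRH ?_
  simp only [sub_re, add_re, one_re, ofReal_re]
  linarith [h.lt_one]

end PrimeWeight

end Literature.NumberTheory.BeurlingPrimes
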